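import Summits.HodgeConjecture.HodgeConjecture.Theorems.MarkmanPartnerTransportPicardThreeK3SquaresSqrtNatSector
import Summits.HodgeConjecture.HodgeConjecture.Theorems.MarkmanPartnerTransportPicardThreeK3SquaresTranscendentalDiagonalEmbedding
import Summits.HodgeConjecture.HodgeConjecture.Theorems.MarkmanPartnerTransportPicardThreeK3SquaresSymplecticLocus
import Summits.HodgeConjecture.HodgeConjecture.Theorems.MarkmanPartnerTransportPicardThreeK3SquaresCMThird
import Literature.AlgebraicGeometry.Surfaces.K3SqrtThreeOfTranscendentalEmbedding

/-!
# Route MarkmanPartnerTransport · crux `PicardThreeK3Squares` (stmt-HodgeConjecture-19652) —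
# the `√3`-sector: HC⁴(S ⊗ S) for every projective K3 surface of Picard rank `≥ 15` whose `T(S)`
# carries a `√3`-similitude (real multiplication by `ℚ(√3)` at `ρ = 16`)

The order-`3` companion of the tree's `√2` theorems (`…PicardTwelveSqrtTwo`: `ρ ≥ 12`, Nikulin
involutions). Print: Varesco 2023 Thm. 2.1 (`√p` algebraic on K3 surfaces Hodge isometric to one with a
symplectic automorphism of order `p`), Prop. 2.11 (for `p = 3` that is `T(X) ⊆ U³_ℚ ⊕ (A₂)²_ℚ`),
Thm. 2.15 / Rem. 2.16 (the two-dimensional families, `ρ = 14`). Here: at `ρ(S) ≥ 15` the lattice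
condition is AUTOMATIC — `dim T(S)_ℚ ≤ 7 ≤ 10 − 3`, so Kitaoka's codimension-`3` representation theorem
embeds `T(S)_ℚ` (indices `(≤ 3, ≤ 7)`) into `(U³ ⊕ A₂²) ⊗ ℚ ≅ ⟨1,1,1,−1,−1,−1,−2,−6,−2,−6⟩`
(`exists_transcendentalEmbedding_weightedSumSquares`) — and the sector clause `End_Hdg(T(S)) = ℚ + ℚψ`
is AUTOMATIC too unless `S` has CM (`sqrtSector_or_hasComplexMultiplication_of_natCast`, `q = 3`:
`3·[E:ℚ] ≤ dim T ≤ 10`). Hence, modulo the named facts `Varesco2023_sqrtThree_algebraic_of_transcendental_embedding`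
(Thm. 2.1 ∘ Prop. 2.11), `Buskin2019_hodgeIsometry_algebraic` (CM branch) and `Huybrechts_K3_marking_exists`:

* `SymplecticLocus.hodgeConjectureFor_square_of_algebraic_similitude` — bookkeeping: an algebraic
  correspondence agreeing with `ψ` on `T(S)` + the sector clause `ℚ + ℚψ` ⟹ HC⁴(S ⊗ S) (the tail of
  `hodgeConjectureFor_square_of_symplecticAutomorphism`, for any `ψ`).
* `NikulinIsogeny.hodgeConjectureFor_square_of_twelve_le_of_sqrtThree_of_embedding` — `ρ(S) ≥ 12`
  with Varesco's lattice condition `T(S)_ℚ ↪ (U³ ⊕ A₂²) ⊗ ℚ` as an explicit hypothesis (covers the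
  two-dimensional `σ₃`-families at `ρ = 14`, all members).
* `NikulinIsogeny.hodgeConjectureFor_square_of_fifteen_le_of_sqrtThree` (+ marking-free `'`):
  **HC⁴(S ⊗ S) for every (marked) projective K3 surface with `ρ(S) ≥ 15` and a rational Hodge
  endomorphism `ψ` of `H²` with `ψ² = 3` and multiplier `3` on `T(S)`** — every projective K3 surface of
  Picard rank `16` with real multiplication by `ℚ(√3)` (the whole one-dimensional real-multiplication
  loci; print had the two-dimensional `σ₃`-families at `ρ = 14` and their members).

No definition, no sorry. Prover seat hodge-nonav-19652-p1 (gen 4), `--supports stmt-HodgeConjecture-19652`.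

References: M. Varesco, Math. Z. 305 (2023), Thm. 2.1, Prop. 2.11, Thm. 2.15, Rem. 2.16; A. Garbagnati,
A. Sarti, J. Algebra 318 (2007), Thm. 5.1; Y. Kitaoka, *Arithmetic of Quadratic Forms*, Cor. 4.1.4;
B. van Geemen, Michigan Math. J. 56 (2008), Lemma 3.2; N. Buskin, J. reine angew. Math. 755 (2019).
-/

set_option linter.dupNamespace false

noncomputable section

namespace Summit.HodgeConjecture.HodgeConjecture.Theorems.MarkmanPartnerTransport.SymplecticLocus

open scoped Manifold
open Module CategoryTheory MonoidalCategory CartesianMonoidalCategory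
open Literature.AlgebraicGeometry Literature.AlgebraicGeometry.Motives Literature.AlgebraicGeometry.HodgeTheory
open Literature.AlgebraicGeometry.Surfaces
open Literature.AlgebraicTopology.SingularHomology
open Summit.HodgeConjecture.HodgeConjecture.Theorems
open Summit.HodgeConjecture.HodgeConjecture.Theorems.NikulinTwinTransport
open Summit.HodgeConjecture.HodgeConjecture.Theorems.NikulinTwinTransport.SquareGlueFree

variable {S : SchemeOver ℂ}

/-- `Corr[μ, hS ; γ, y] = pr₁_*(pr₂^* y ∪ γ)` on `H²(S(ℂ); ℂ)`. Local notation only. -/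
local notation3 (prettyPrint := false) "Corr[" μ ", " hS " ; " γ ", " y "]" =>
  complexGysin μ (IsSmoothProjective.tensor_holds hS hS) hS
    (SemiCartesianMonoidalCategory.fst _ _) (rfl : 2 * 1 + 2 * 2 + 2 * 2 = 2 * 1 + 2 * (2 + 2))
    (cupProduct (rfl : 2 * 1 + 2 * 2 = 2 * 1 + 2 * 2)
      (complexBetti.map (SemiCartesianMonoidalCategory.snd _ _) (2 * 1) y) γ)

/-- **Bookkeeping: an algebraic correspondence agreeing with `ψ` on `T(S)`, plus the sector clause
`End_Hdg(T(S)) ⊆ ℚ + ℚψ`, give HC⁴(S ⊗ S)** for a projective K3 surface `S` (the tail of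
`hodgeConjectureFor_square_of_symplecticAutomorphism`, valid for any `ψ`): write `T₀ = [γ]_*`
(`exists_corr_of_isAlgebraicCorrespondence`), compose with the transcendental projector `Q = [γ_Q]_*`
(`exists_corr_transcendentalProjector`, `corrComp_surfaces_of_cup`); `g = a + b·T₀∘Q` is `N¹`-stable,
cycle-induced and equals `f` on `T`; conclude by `CycleInducedSector.hodgeConjectureFor_square_of_cycleInducedSector`.
[cite: Varesco2023, §2 (p. 8) and Thm. 2.1] [cite: Fulton1998, §16.1 Prop. 16.1.1] -/
theorem hodgeConjectureFor_square_of_algebraic_similitude (hS : IsK3Surface S)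
    (ψ T₀ : complexBetti S (2 * 1) →ₗ[ℂ] complexBetti S (2 * 1)) (hT₀alg : IsAlgebraicCorrespondence 2 2 S S T₀)
    (hT₀ψ : ∀ x ∈ transcendentalSubspace S, T₀ x = ψ x)
    (hU : ∀ (f : complexBetti S (2 * 1) →ₗ[ℂ] complexBetti S (2 * 1)),
      (∀ y, IsRationalClass y → IsRationalClass (f y)) →
      (∀ (i j : ℕ) y, IsOfHodgeType 2 S (2 * 1) i j y → IsOfHodgeType 2 S (2 * 1) i j (f y)) →
      (∀ d ∈ algebraicClasses S 1, f d = 0) →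
      (∀ y : complexBetti S (2 * 1), ∀ d ∈ algebraicClasses S 1,
        cupProduct (rfl : 2 * 1 + 2 * 1 = 2 * 2) (f y) d = 0) →
      ∃ a b : ℚ, ∀ y : complexBetti S (2 * 1),
        (∀ d ∈ algebraicClasses S 1, cupProduct (rfl : 2 * 1 + 2 * 1 = 2 * 2) y d = 0) →
        f y = (a : ℂ) • y + (b : ℂ) • ψ y) :
    HodgeConjectureFor 4 (S ⊗ S) := by
  have h4 : 2 * 1 + 2 * 1 = 2 * 2 := rfl
  set μ : OrientationFamily := complexOrientationFamily with hμdef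
  obtain ⟨γ, hγalg, hγ⟩ := exists_corr_of_isAlgebraicCorrespondence μ hS.isSmoothProjective hT₀alg
  obtain ⟨Q, γQ, hγQalg, hQ, hQN, hQT⟩ := exists_corr_transcendentalProjector μ hS.isSmoothProjective
  -- `T₀ ∘ Q` is cycle-induced
  obtain ⟨γ₂, hγ₂alg, hγ₂⟩ := corrComp_surfaces_of_cup μ
    SquareOfGenerator.cupProduct_mem_algebraicClasses_tripleProduct S S S hS.isSmoothProjective
    hS.isSmoothProjective hS.isSmoothProjective γ hγalg γQ hγQalg
  -- the diagonal
  set δ : complexBetti (S ⊗ S) (2 * 2) :=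
    complexGysin μ hS.isSmoothProjective (IsSmoothProjective.tensor_holds hS.isSmoothProjective hS.isSmoothProjective)
      (lift (𝟙 S) (𝟙 S)) (rfl : 0 + 2 * (2 + 2) = 2 * 2 + 2 * 2) (singularCohomology.one ℂ (ComplexPoints S))
    with hδdef
  have hδalg : δ ∈ algebraicClasses (S ⊗ S) 2 := diagonal_mem_algebraicClasses μ hS.isSmoothProjective _
  have hδact : ∀ y : complexBetti S (2 * 1), Corr[μ, hS.isSmoothProjective ; δ, y] = y := fun y ↦
    corrFst_diagonal μ hS.isSmoothProjective (rfl : 2 * 1 + 2 * 2 = 2 * 1 + 2 * 2)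
      (rfl : 2 * 1 + 2 * 2 + 2 * 2 = 2 * 1 + 2 * (2 + 2)) (rfl : 0 + 2 * (2 + 2) = 2 * 2 + 2 * 2) y
  -- `y ⊥ N¹` lies in `transcendentalSubspace S`
  have hmemT : ∀ y : complexBetti S (2 * 1),
      (∀ d ∈ algebraicClasses S 1, cupProduct h4 y d = 0) → y ∈ transcendentalSubspace S := by
    intro y hy
    rw [mem_transcendentalSubspace_iff]
    intro c hc
    rw [cupProduct_gradedComm_holds ℂ _ h4 h4, hy c hc.2, smul_zero]
  refine CycleInducedSector.hodgeConjectureFor_square_of_cycleInducedSector μ hS.isSmoothProjective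
    fun f hf₁ hf₂ hf₃ hf₄ ↦ ?_
  obtain ⟨a, b, hab⟩ := hU f hf₁ hf₂ hf₃ hf₄
  refine ⟨(a : ℂ) • LinearMap.id + (b : ℂ) • (T₀ ∘ₗ Q), fun d hd ↦ ?_,
    ⟨(a : ℂ) • δ + (b : ℂ) • γ₂, Submodule.add_mem _ (Submodule.smul_mem _ _ hδalg)
      (Submodule.smul_mem _ _ hγ₂alg), fun y ↦ ?_⟩, fun y hy ↦ ?_⟩
  · rw [LinearMap.add_apply, LinearMap.smul_apply, LinearMap.smul_apply, LinearMap.id_apply,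
      LinearMap.comp_apply, hQN d hd, map_zero, smul_zero, add_zero]
    exact Submodule.smul_mem _ _ hd
  · rw [LinearMap.add_apply, LinearMap.smul_apply, LinearMap.smul_apply, LinearMap.id_apply,
      LinearMap.comp_apply, map_add, map_smul, map_smul, map_add, map_smul, map_smul, hδact, hγ₂ y, ← hQ y,
      ← hγ (Q y)]
  · rw [hab y hy, LinearMap.add_apply, LinearMap.smul_apply, LinearMap.smul_apply, LinearMap.id_apply,
      LinearMap.comp_apply, hQT y hy, hT₀ψ y (hmemT y hy)]

end Summit.HodgeConjecture.HodgeConjecture.Theorems.MarkmanPartnerTransport.SymplecticLocus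

namespace Summit.HodgeConjecture.HodgeConjecture.Theorems.MarkmanPartnerTransport.NikulinIsogeny

open scoped TensorProduct
open Module CategoryTheory MonoidalCategory
open Literature.AlgebraicGeometry Literature.AlgebraicGeometry.Motives Literature.AlgebraicGeometry.HodgeTheory
open Literature.AlgebraicGeometry.Surfaces
open Literature.AlgebraicTopology.SingularHomology
open Summit.HodgeConjecture.HodgeConjecture.Theorems
open Summit.HodgeConjecture.HodgeConjecture.Theorems.NikulinTwinTransport
open Summit.HodgeConjecture.HodgeConjecture.Theorems.MarkmanPartnerTransport

variable {S : SchemeOver ℂ}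

/-- `MarkedK3[S, η, p, x]`: VERBATIM the `let MarkedK3 := …` binder of the route declaration
`PicardThreeK3Squares`. Local notation only. -/
local notation3 (prettyPrint := false) "MarkedK3[" S ", " η ", " p ", " x "]" =>
  (p ≠ 0 ∧ (IsIntegralClass p ∧
    (∀ q : complexBetti S (2 * 2), IsIntegralClass q → ∃ n : ℤ, q = n • p) ∧
    (∀ c : complexBetti S (2 * 1), IsIntegralClass c ↔ ∃ v : K3Index → ℤ, η c = fun i => (v i : ℂ)) ∧
    (∀ a b : complexBetti S (2 * 1),
      cupProduct (rfl : 2 * 1 + 2 * 1 = 2 * 2) a b = k3Form (η a) (η b) • p) ∧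
    IsOfHodgeType 2 S (2 * 1) 2 0 (LinearEquiv.symm η x) ∧
    (∀ τ : complexBetti S (2 * 1), IsOfHodgeType 2 S (2 * 1) 2 0 τ →
      ∃ t : ℂ, τ = t • LinearEquiv.symm η x)) ∧
    (k3Form x x = 0 ∧ 0 < (k3Form (star x) x).re ∧
      ∃ u : K3Index → ℤ, k3Form (fun i => (u i : ℂ)) x = 0 ∧ 0 < ∑ i, ∑ j, u i * k3Gram i j * u j))

/-! ### The weights of `(U³ ⊕ A₂²) ⊗ ℚ` -/

/-- The diagonal avatar `⟨1,1,1,−1,−1,−1,−2,−6,−2,−6⟩` of `(U³ ⊕ A₂²) ⊗ ℚ` has non-zero weights. -/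
theorem u3a2Weights_ne_zero : ∀ i : Fin 10, (![1, 1, 1, -1, -1, -1, -2, -6, -2, -6] : Fin 10 → ℚ) i ≠ 0 := by
  intro i
  fin_cases i <;> simp

/-- … exactly `3` positive weights … -/
theorem ncard_u3a2Weights_pos : {i : Fin 10 | 0 < (![1, 1, 1, -1, -1, -1, -2, -6, -2, -6] : Fin 10 → ℚ) i}.ncard = 3 := by
  have h : {i : Fin 10 | 0 < (![1, 1, 1, -1, -1, -1, -2, -6, -2, -6] : Fin 10 → ℚ) i} =
      (({0, 1, 2} : Finset (Fin 10)) : Set (Fin 10)) := by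
    ext i
    fin_cases i <;> simp
  rw [h, Set.ncard_coe_finset]
  rfl

/-- … and exactly `7` negative weights (signature `(3, 7)`). -/
theorem ncard_u3a2Weights_neg : {i : Fin 10 | (![1, 1, 1, -1, -1, -1, -2, -6, -2, -6] : Fin 10 → ℚ) i < 0}.ncard = 7 := by
  have h : {i : Fin 10 | (![1, 1, 1, -1, -1, -1, -2, -6, -2, -6] : Fin 10 → ℚ) i < 0} =
      (({3, 4, 5, 6, 7, 8, 9} : Finset (Fin 10)) : Set (Fin 10)) := by
    ext i
    fin_cases i <;> simp
  rw [h, Set.ncard_coe_finset]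
  rfl

/-! ### The `√3`-sector: Picard rank `≥ 12` with the lattice condition, and Picard rank `≥ 15` -/

/-- **HC⁴(S ⊗ S) for a marked projective K3 surface with `ρ(S) ≥ 12`, a `√3`-similitude `ψ` of
`T(S)`, and `T(S)_ℚ ↪ (U³ ⊕ A₂²) ⊗ ℚ`** (Varesco's Prop. 2.11 hypothesis, as an isometric embedding `ι`
of the transcendental coordinate vectors into `⟨1,1,1,−1,−1,−1,−2,−6,−2,−6⟩`, injective there) — this
covers Varesco's two-dimensional families at `ρ = 14` (Thm. 2.15, Rem. 2.16: ALL members) — modulo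
`Buskin2019_hodgeIsometry_algebraic` (CM branch), `Huybrechts_K3_marking_exists` and
`Varesco2023_sqrtThree_algebraic_of_transcendental_embedding`. Proof: either `S` has CM (Buskin:
`CMThird.hodgeConjectureFor_square_of_CM_of_buskin`) or the `√3`-sector data hold
(`sqrtSector_or_hasComplexMultiplication_of_natCast`, `q = 3`); the named fact yields an algebraic
correspondence `= ψ` on `T(S)`, and `SymplecticLocus.hodgeConjectureFor_square_of_algebraic_similitude`
concludes. [cite: Varesco2023, Thm. 2.1, Prop. 2.11, Thm. 2.15 and Rem. 2.16] [cite: Vangeemen2008, Lemma 3.2]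
[cite: Buskin2019, Thm. 1.1 and Corollary] -/
theorem hodgeConjectureFor_square_of_twelve_le_of_sqrtThree_of_embedding
    (hB : Buskin2019_hodgeIsometry_algebraic) (hmark : Huybrechts_K3_marking_exists)
    (hV : Varesco2023_sqrtThree_algebraic_of_transcendental_embedding) (hS : IsK3Surface S)
    (η : complexBetti S (2 * 1) ≃ₗ[ℂ] (K3Index → ℂ)) (p : complexBetti S (2 * 2)) (x : K3Index → ℂ)
    (hM : MarkedK3[S, η, p, x]) (hρ : 12 ≤ Module.finrank ℂ ↥(algebraicClasses S 1))
    (ι : (K3Index → ℚ) →ₗ[ℚ] (Fin 10 → ℚ))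
    (hiso : ∀ v w : K3Index → ℚ, IsTranscendentalCoord S η v → IsTranscendentalCoord S η w →
      ∑ i : Fin 10, (![1, 1, 1, -1, -1, -1, -2, -6, -2, -6] : Fin 10 → ℚ) i * ι v i * ι w i =
        k3FormRat v w)
    (hinj : ∀ v : K3Index → ℚ, IsTranscendentalCoord S η v → ι v = 0 → v = 0)
    (ψ : complexBetti S (2 * 1) →ₗ[ℂ] complexBetti S (2 * 1))
    (hψrat : ∀ y, IsRationalClass y → IsRationalClass (ψ y))
    (hψtyp : ∀ (i j : ℕ) y, IsOfHodgeType 2 S (2 * 1) i j y → IsOfHodgeType 2 S (2 * 1) i j (ψ y))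
    (hψsq : ∀ y ∈ transcendentalSubspace S, ψ (ψ y) = (3 : ℂ) • y)
    (hψmul : ∀ y ∈ transcendentalSubspace S, ∀ z ∈ transcendentalSubspace S,
      cupProduct (rfl : 2 * 1 + 2 * 1 = 2 * 2) (ψ y) (ψ z) =
        (3 : ℂ) • cupProduct (rfl : 2 * 1 + 2 * 1 = 2 * 2) y z) :
    HodgeConjectureFor 4 (S ⊗ S) := by
  have h3 : ¬ IsSquare (3 : ℕ) := irrational_sqrt_natCast_iff.1 Nat.prime_three.irrational_sqrt
  rcases sqrtSector_or_hasComplexMultiplication_of_natCast h3 hS η p x hM hρ ψ hψrat hψtyp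
      (fun y hy ↦ by simpa using hψsq y hy)
      (fun y hy z hz ↦ by simpa using hψmul y hy z hz) with hsec | hCM
  · obtain ⟨hψT, hψratT, hψtypT, hψsqT, hψmulT, hU⟩ := hsec
    obtain ⟨hp₀, ⟨hpint, hpgen, hηint, hηcup, -, -⟩, -⟩ := hM
    obtain ⟨T₀, hT₀alg, hT₀ψ⟩ := hV hS η p hp₀ hpint hpgen hηint hηcup ι hiso hinj ψ hψT hψratT hψtypT
      (fun y hy ↦ by simpa using hψsqT y hy)
      (fun y hy z hz ↦ by simpa using hψmulT y hy z hz)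
    exact SymplecticLocus.hodgeConjectureFor_square_of_algebraic_similitude hS ψ T₀ hT₀alg hT₀ψ hU
  · exact CMThird.hodgeConjectureFor_square_of_CM_of_buskin hB hmark S hS hCM

/-- **HC⁴(S ⊗ S) for every marked projective K3 surface with `ρ(S) ≥ 15` whose `H²` carries a rational
Hodge endomorphism `ψ` with `ψ² = 3` and multiplier `3` on `T(S)`** — e.g. EVERY projective K3 surface of
Picard rank `16` with real multiplication by `ℚ(√3)` — modulo `Buskin2019_hodgeIsometry_algebraic`
(CM branch), `Huybrechts_K3_marking_exists`, and `Varesco2023_sqrtThree_algebraic_of_transcendental_embedding`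
(Varesco Thm. 2.1 ∘ Prop. 2.11): at `ρ(S) ≥ 15`, `dim T(S)_ℚ ≤ 7`, so the lattice condition of
`hodgeConjectureFor_square_of_twelve_le_of_sqrtThree_of_embedding` is AUTOMATIC
(`exists_transcendentalEmbedding_weightedSumSquares`: Kitaoka's codimension-`3` representation theorem,
indices `(≤ 3, ≤ 7)` into `(3, 7)`). [cite: Varesco2023, Thm. 2.1, Prop. 2.11 and Rem. 2.16]
[cite: Kitaoka1993, Ch. 4 Cor. 4.1.4] [cite: Vangeemen2008, Lemma 3.2] [cite: Buskin2019, Thm. 1.1 and Corollary] -/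
theorem hodgeConjectureFor_square_of_fifteen_le_of_sqrtThree (hB : Buskin2019_hodgeIsometry_algebraic)
    (hmark : Huybrechts_K3_marking_exists) (hV : Varesco2023_sqrtThree_algebraic_of_transcendental_embedding)
    (hS : IsK3Surface S)
    (η : complexBetti S (2 * 1) ≃ₗ[ℂ] (K3Index → ℂ)) (p : complexBetti S (2 * 2)) (x : K3Index → ℂ)
    (hM : MarkedK3[S, η, p, x]) (hρ : 15 ≤ Module.finrank ℂ ↥(algebraicClasses S 1))
    (ψ : complexBetti S (2 * 1) →ₗ[ℂ] complexBetti S (2 * 1))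
    (hψrat : ∀ y, IsRationalClass y → IsRationalClass (ψ y))
    (hψtyp : ∀ (i j : ℕ) y, IsOfHodgeType 2 S (2 * 1) i j y → IsOfHodgeType 2 S (2 * 1) i j (ψ y))
    (hψsq : ∀ y ∈ transcendentalSubspace S, ψ (ψ y) = (3 : ℂ) • y)
    (hψmul : ∀ y ∈ transcendentalSubspace S, ∀ z ∈ transcendentalSubspace S,
      cupProduct (rfl : 2 * 1 + 2 * 1 = 2 * 2) (ψ y) (ψ z) =
        (3 : ℂ) • cupProduct (rfl : 2 * 1 + 2 * 1 = 2 * 2) y z) :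
    HodgeConjectureFor 4 (S ⊗ S) := by
  obtain ⟨ι, hiso, hinj⟩ := exists_transcendentalEmbedding_weightedSumSquares hS η p x hM
    (![1, 1, 1, -1, -1, -1, -2, -6, -2, -6] : Fin 10 → ℚ) u3a2Weights_ne_zero
    (by rw [ncard_u3a2Weights_pos]) (by rw [ncard_u3a2Weights_neg]; omega) (by omega)
  exact hodgeConjectureFor_square_of_twelve_le_of_sqrtThree_of_embedding hB hmark hV hS η p x hM (by omega)
    ι hiso hinj ψ hψrat hψtyp hψsq hψmul

/-- **Marking-free form: every projective K3 surface of Picard rank `≥ 15` whose `H²` carries a rational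
Hodge endomorphism `ψ` with `ψ² = 3` and multiplier `3` on `T(S)` (real multiplication by `√3`) satisfies
the Hodge conjecture for `S ⊗ S`**, modulo the three named facts. [cite: Varesco2023, Thm. 2.1 and Prop. 2.11]
[cite: Vangeemen2008, Lemma 3.2] [cite: Kitaoka1993, Ch. 4 Cor. 4.1.4] -/
theorem hodgeConjectureFor_square_of_fifteen_le_of_sqrtThree' (hB : Buskin2019_hodgeIsometry_algebraic)
    (hmark : Huybrechts_K3_marking_exists) (hV : Varesco2023_sqrtThree_algebraic_of_transcendental_embedding)
    (hS : IsK3Surface S) (hρ : 15 ≤ Module.finrank ℂ ↥(algebraicClasses S 1))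
    (ψ : complexBetti S (2 * 1) →ₗ[ℂ] complexBetti S (2 * 1))
    (hψrat : ∀ y, IsRationalClass y → IsRationalClass (ψ y))
    (hψtyp : ∀ (i j : ℕ) y, IsOfHodgeType 2 S (2 * 1) i j y → IsOfHodgeType 2 S (2 * 1) i j (ψ y))
    (hψsq : ∀ y ∈ transcendentalSubspace S, ψ (ψ y) = (3 : ℂ) • y)
    (hψmul : ∀ y ∈ transcendentalSubspace S, ∀ z ∈ transcendentalSubspace S,
      cupProduct (rfl : 2 * 1 + 2 * 1 = 2 * 2) (ψ y) (ψ z) =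
        (3 : ℂ) • cupProduct (rfl : 2 * 1 + 2 * 1 = 2 * 2) y z) :
    HodgeConjectureFor 4 (S ⊗ S) := by
  obtain ⟨η, p, x, hM⟩ := hmark S hS
  exact hodgeConjectureFor_square_of_fifteen_le_of_sqrtThree hB hmark hV hS η p x hM hρ ψ hψrat hψtyp hψsq hψmul

end Summit.HodgeConjecture.HodgeConjecture.Theorems.MarkmanPartnerTransport.NikulinIsogeny

end
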